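import Mathlib
import Summits.CriticalPhenomena.Statement

/-!
# Sketch — crux-ideate stmt-CriticalPhenomena-1344 (MoebiusLimit), ideator 3, round 1

First lemmas of the idea card `cubical-staircase-dilation-operator` (folder Ideas/), stated over
existing declarations only. Nothing here is proved; the file must merely elaborate.

* `BimeshSeamLaw Js` — the ENTRY statement of the line (Δ-free, ρ-free transparency of one tuned
  planar 2:1 misfit seam between a fine half-crystal `ℤ³ ∩ {x₀ < 0}` and a coarse half-crystal
  `2ℤ³ ∩ {x₀ ≥ 0}`, glued along the plane `x₀ = 0`): the two-point function ACROSS the seam is the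
  geometric mean of the bulk `ℤ³` two-point functions read in the fine and in the coarse mesh.
* `DyadicAxisExponentGivesEta` — the EXIT statement (provable now from Messager–Miracle-Solé,
  in tree): a dyadic axial decay exponent of `criticalTwoPoint 3` is the exponent `η` in the sense
  of `HasIsingExponentEta 3`.
-/

noncomputable section

namespace Summit.CriticalPhenomena.Ising3DConformalLimit.Cruxes.MoebiusLimit.CubicalStaircase

open Literature.Probability.LatticeModels Filter Topology Classical

/-! ### The planar 2:1 misfit seam ("bimesh half-space crystal") on the vertex set `Site 3` -/

/-- Live coarse sites: the half-space `x₀ ≥ 0` carries the lattice `2ℤ³` (all coordinates even);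
the other sites of that half-space are isolated (never bonded) and immaterial. -/
def CoarseLive (x : Site 3) : Prop := 0 ≤ x 0 ∧ ∀ i, Even (x i)

/-- Fine sites: the open half-space `x₀ < 0` carries `ℤ³` itself. -/
def FineLive (x : Site 3) : Prop := x 0 < 0

/-- Fine–fine bonds: nearest neighbours of `ℤ³` inside `x₀ < 0`. -/
def FineBond (x y : Site 3) : Prop := FineLive x ∧ FineLive y ∧ (zdGraph 3).Adj x y

/-- Coarse–coarse bonds: nearest neighbours of `2ℤ³` inside `x₀ ≥ 0` (steps `±2eᵢ`). -/
def CoarseBond (x y : Site 3) : Prop :=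
  CoarseLive x ∧ CoarseLive y ∧ ∃ i : Fin 3, y = x + Pi.single i 2 ∨ x = y + Pi.single i 2

/-- Seam bonds (oriented fine → coarse): the last fine layer `x₀ = -1` is bonded to the first coarse
layer `y₀ = 0`, each fine site to the live coarse sites within transverse sup-distance `1`
(a period-2 pattern: the seam is HOMOGENEOUS, hence carries one tunable coupling `Js`). -/
def SeamBond (x y : Site 3) : Prop :=
  x 0 = -1 ∧ CoarseLive y ∧ y 0 = 0 ∧ ∀ i : Fin 3, i ≠ 0 → |x i - y i| ≤ 1

/-- Symmetric coupling kernel of the bimesh crystal: `β_c(3)` on fine and coarse bonds, `Js` on seam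
bonds, `0` otherwise (halved because the Hamiltonian below double counts ordered pairs). -/
def bimeshCoupling (Js : ℝ) (x y : Site 3) : ℝ :=
  (if FineBond x y ∨ CoarseBond x y then criticalBeta 3 else 0) / 2 +
    (if SeamBond x y ∨ SeamBond y x then Js else 0) / 2

/-- Spin value of a configuration on the finite window `Λ`, read at an arbitrary site (`+1` off `Λ`;
never used off `Λ`). -/
def spinOf (Λ : Finset (Site 3)) (σ : ↥Λ → Bool) (x : Site 3) : ℝ :=
  if h : x ∈ Λ then (if σ ⟨x, h⟩ then 1 else -1) else 1

/-- Free-boundary finite-volume Gibbs average of `f` on the window `Λ` for the coupling kernel `c`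
(inlined finite Gibbs formula, as in route LogPolarProxy rev 2). -/
def gibbsAvg (Λ : Finset (Site 3)) (c : Site 3 → Site 3 → ℝ)
    (f : (Site 3 → ℝ) → ℝ) : ℝ :=
  (∑ σ : ↥Λ → Bool, f (spinOf Λ σ) *
      Real.exp (∑ a ∈ Λ, ∑ b ∈ Λ, c a b * spinOf Λ σ a * spinOf Λ σ b)) /
    (∑ σ : ↥Λ → Bool, Real.exp (∑ a ∈ Λ, ∑ b ∈ Λ, c a b * spinOf Λ σ a * spinOf Λ σ b))

/-- Infinite-volume (free b.c., increasing boxes; the limit exists by GKS monotonicity) two-point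
function of the bimesh crystal with seam coupling `Js`. -/
def bimeshTwoPoint (Js : ℝ) (x y : Site 3) : ℝ :=
  limUnder atTop fun L : ℕ => gibbsAvg (box 3 L) (bimeshCoupling Js) fun s => s x * s y

/-- Halving of an (even) lattice vector: the coarse-mesh reading of a separation. -/
def halfSite (v : Site 3) : Site 3 := fun i => v i / 2

/-- **First lemma of the line (entry): the Δ-free, ρ-free 2:1 SEAM LAW.** For the tuned seam
coupling `Js` the two-point function across the seam is asymptotically the geometric mean of the
bulk critical two-point functions of `ℤ³` read in the fine mesh (`y - x`) and in the coarse mesh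
(`(y - x)/2`), uniformly over pairs receding from the seam proportionally to their separation:
`bimeshTwoPoint Js x y ^ 2 / (⟨σ₀σ_{y-x}⟩_{β_c} · ⟨σ₀σ_{(y-x)/2}⟩_{β_c}) → 1`.
(CFT reading: transparent trivial interface + LOCAL renormalisation `ρ(δ)ρ(2δ)`.) -/
def BimeshSeamLaw (Js : ℝ) : Prop :=
  ∀ ε : ℝ, 0 < ε → ∀ θ : ℝ, 0 < θ → ∃ R : ℝ, ∀ x y : Site 3, FineLive x → CoarseLive y →
    R ≤ ‖y - x‖ → θ * ‖y - x‖ ≤ |((x 0 : ℤ) : ℝ)| → θ * ‖y - x‖ ≤ ((y 0 : ℤ) : ℝ) →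
      |bimeshTwoPoint Js x y ^ 2 /
          (criticalTwoPoint 3 (y - x) * criticalTwoPoint 3 (halfSite (y - x))) - 1| ≤ ε

/-- The seam's plane-ordering threshold (GKS: everything is monotone in `Js`): the infimum of the
seam couplings at which the seam layer acquires long-range order at bulk `β_c(3)`. -/
def seamThreshold : ℝ :=
  sInf {Js : ℝ | 0 ≤ Js ∧ ∃ m : ℝ, 0 < m ∧ ∀ y y' : Site 3, CoarseLive y → CoarseLive y' →
    y 0 = 0 → y' 0 = 0 → m ≤ bimeshTwoPoint Js y y'}

/-- The transparency crux of the line, one number: the seam law holds AT the threshold. -/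
def TunedSeamTransparent : Prop := BimeshSeamLaw seamThreshold

/-! ### Exit lemma on `ℤ³` alone -/

/-- **Exit lemma (provable now: MMS `G(x) ≤ G(‖x‖_∞ e₁)`, `G(x) ≥ G(‖x‖₁ e₁)`, monotonicity along
the axis, positivity from `criticalTwoPoint_bounds_holds`).** If the critical two-point function of
`ℤ³` has a decay exponent along the dyadic axial sequence `2^k e₀`, then `η` exists in the sense of
`HasIsingExponentEta 3` (log-ratio along `cofinite`). This is where the staircase's Perron–Frobenius
exponent lands. -/
def DyadicAxisExponentGivesEta : Prop :=
  ∀ η : ℝ,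
    Tendsto (fun k : ℕ =>
        Real.log (criticalTwoPoint 3 (Pi.single 0 ((2 : ℤ) ^ k))) / ((k : ℝ) * Real.log 2))
      atTop (𝓝 (-(1 + η))) →
    HasIsingExponentEta 3 η

/-- Sanity: the exit lemma's conclusion is the tree's `η`-exponent notion at `d = 3`
(`d - 2 + η = 1 + η`). -/
example (η : ℝ) : HasIsingExponentEta 3 η ↔
    HasSpatialDecayExponent (criticalTwoPoint 3) ((3 : ℝ) - 2 + η) := Iff.rfl

end Summit.CriticalPhenomena.Ising3DConformalLimit.Cruxes.MoebiusLimit.CubicalStaircase
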